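import Summits.BirchSwinnertonDyer.BirchSwinnertonDyer.Theorems.TeichmullerTwistDescentCarrierDefs
import Literature.RepresentationTheory.FiniteGroups.GL2ModularPrincipalSeriesLatticeReductionImage
import HarnessLib

/-!
# Route `TeichmullerTwistDescent`, crux K `TwistedPeriodLatticeSaturation` (stmt-BirchSwinnertonDyer-25368):
# the integral carrier functional SPLIT — K from modularity, a RATIONAL tame-type functional and a mod-`p`
# WEIGHT EXCLUSION

Cell `pub/bsd-wall` (D-0145 line route-BirchSwinnertonDyer-TeichmullerTwistDescent, OPEN rev 7), seat `bsd-line-ttd-p1`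
(prover 1/2, g25).  THEOREMS ONLY (no definition, no named fact, no `sorry`); `--supports stmt-BirchSwinnertonDyer-25368`.
BSD is not proved by this file; K is NOT proved by this file (it stays CONDITIONAL); nothing here closes an item.

WHAT.  g24 proved K conditionally on modularity (`exists_isNewformOf`) and ONE route-posited input,
`IntegralTameTypeCarrierFunctional` (`hcar`): an equivariant `ℤ_p`-functional `Ψ` from the spread lattice `Λ_Q(f_D)` of
the full-level carrier `H₁(Γ₀(M), ℤ_p[GL₂(𝔽_p)])` to the Bruhat model `L` of `Ind(ω̃^{p−1−b} ⊗ ω̃ᵇ)` with finite-index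
image whose reduction has socle `⊆ {Sym^{2b} ⊗ det^{−b}}`, and suggested typing it from Emerton–Gee–Savitt 2015 /
Le–Morra–Schraen 2016 (Breuil lattices).  This file shows that the socle clause is NOT lattice-theoretic input of that
depth: by the tree's structure theory of the mod-`p` principal series (`L/pL` uniserial of length two, socle
`Sym^{2b} ⊗ det^{−b}`, cosocle `Sym^{p−1−2b} ⊗ detᵇ`) and the new Literature lemmas
(`GL2ModularPrincipalSeriesLatticeReductionImage`: division by the exact power of `p`, Nakayama saturation, the
socle-quotient alternative, the socle condition for the standard lattice),

  `IntegralTameTypeCarrierFunctional ⟸ RationalTameTypeCarrierFunctional ∧ NoEtaleWeightQuotient`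
  (**`integralTameTypeCarrierFunctional_of_rational_of_noEtaleWeightQuotient`**), hence
  **`twistedPeriodLatticeSaturation_of_rational_of_noEtaleWeightQuotient (hnf) (hrat) (hwt) : K`** (route decl verbatim),

where (definitions in `TeichmullerTwistDescentCarrierDefs`, `b = tameExponent p W = (p−1)·ord_pΔ_min/12`):
* `RationalTameTypeCarrierFunctional` (I1″) — the same functional WITHOUT any socle clause (finite-index image only): the
  automorphic-type statement «`Ind(ω̃^{−b} ⊗ ω̃ᵇ)` occurs in the `f_W`-part of `H₁(Y(K(p)K₀(M)), ℚ_p)`», i.e. the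
  Teichmüller twist `f_W ⊗ ω̃^{±b}` has level `pM` (local Langlands / Carayol at `p`);
* `NoEtaleWeightQuotient` (W″) — `Λ_Q(f_D)` has no nonzero equivariant map to `Sym^{2b}(𝔽_p²) ⊗ (ω^{−b} ∘ det)`: the
  SERRE-WEIGHT EXCLUSION «`Sym^{2b} ⊗ det^{−b}` is not a weight of `ρ̄_W`» for the UNSTARRED potentially ordinary curve
  (`ρ̄_W|I_p ∼ (ω^{1−b} ∗; 0 ωᵇ)`; Ash–Stevens 1986 Thm. 3.5 + Deligne / Fontaine, Edixhoven 1992 Thms. 2.5–2.6).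

PROOF.  Divide `Ψ` by the exact power `pᶜ` (`exists_eq_pow_smul_not_forall_dvd`); the quotient `Ψ₁` is still equivariant
(cancellation) with finite-index image `Λ' ⊄ pL`.  If `Λ' ≠ L`, the socle-quotient alternative
(`exists_surjective_symPowTwist_of_ne_top`) gives an equivariant surjection `Λ' ↠ Sym^{2b} ⊗ (ω^{−b}∘det)`, and composing
with `Ψ₁` an equivariant SURJECTIVE `Φ : Λ_Q(f_D) → Sym^{2b} ⊗ (ω^{−b}∘det)`, which (W″) forces to vanish — absurd
(`X₀^{2b} ≠ 0`).  So `Λ' = L`, and `L` satisfies `ReductionSocleLe … (2b)`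
(`exists_injective_symPowTwist_of_toSubmodule_eq_top`).
[cite: EmertonGeeSavitt2015, §3.2, Lemma 4.1.1] [cite: SerreLinearRepresentations1977, §15.1–15.2]
[cite: AshStevens1986, Thm. 3.5] [cite: Edixhoven1992, Thm. 2.5–2.6]
-/

set_option autoImplicit false
-- single-conjunct summit: `Summit.BirchSwinnertonDyer.BirchSwinnertonDyer.…` repeats the name by design
set_option linter.dupNamespace false

noncomputable section

open scoped Pointwise MatrixGroups TensorProduct

open Function CongruenceSubgroup
open Literature.RepresentationTheory.FiniteGroups Literature.RepresentationTheory.FiniteGroups.GL2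
  Literature.NumberTheory.EllipticCurves.ModularForms
open Literature.NumberTheory.EllipticCurves (Kato2004.teichmullerChar)
open Literature.NumberTheory.ModularSymbols Literature.NumberTheory.ModularSymbols.FullLevel
open Literature.Algebra.Homology

namespace Summit.BirchSwinnertonDyer.BirchSwinnertonDyer.Theorems.TeichmullerTwistDescent

open WeierstrassCurve Literature.NumberTheory.EllipticCurves

namespace KOfWeightExclusion

/-! ### The split theorem -/

/-- **`IntegralTameTypeCarrierFunctional` from the rational functional and the weight exclusion.**  Divide the
rational functional `Ψ` by the exact power of `p`; the image of the quotient `Ψ₁` is a finite-index stable sublattice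
of the standard lattice not inside `pL`; if it were not everything, `Λ_Q(f_D)` would map onto
`Sym^{2b}(𝔽_p²) ⊗ (ω^{−b} ∘ det)` (socle-quotient alternative), contradicting `NoEtaleWeightQuotient`; so `Ψ₁` is onto,
and the standard lattice satisfies the reduction-socle condition. BSD is not proved by this; K is not proved by this.
[cite: EmertonGeeSavitt2015, §3.2, Lemma 4.1.1] [cite: SerreLinearRepresentations1977, §15.1–15.2] -/
theorem integralTameTypeCarrierFunctional_of_rational_of_noEtaleWeightQuotient
    (hrat : RationalTameTypeCarrierFunctional) (hwt : NoEtaleWeightQuotient) :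
    IntegralTameTypeCarrierFunctional := by
  intro p M _ _ _ hpM _ _ W _ _ hN D hp11 hadd hirr hGo hV4
  obtain ⟨hb, hb2, m, Ψ, hΨ, hm⟩ := hrat p M hpM W hN D hp11 hadd hirr hGo hV4
  letI : Algebra ℤ_[p] (ZMod p) := (PadicInt.toZMod (p := p)).toAlgebra
  -- the coefficient data `ℤ_p → 𝔽_p`, `ϖ = p`
  have hsurj : Surjective (algebraMap ℤ_[p] (ZMod p)) := ZMod.ringHom_surjective _
  have hker : ∀ a : ℤ_[p], algebraMap ℤ_[p] (ZMod p) a = 0 ↔ (p : ℤ_[p]) ∣ a :=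
    padicInt_algebraMap_eq_zero_iff p (padicInt_ker_eq_maximalIdeal p hsurj)
  have halg : ∀ x : ℤ_[p], algebraMap ℤ_[p] (ZMod p) x = ZMod.castHom (dvd_refl p) (ZMod p) (PadicInt.toZMod x) := by
    intro x
    rw [ZMod.castHom_self, RingHom.id_apply]
    rfl
  have hreg : ∀ a : ℤ_[p], (p : ℤ_[p]) * a = 0 → a = 0 := padicInt_mul_eq_zero p
  have hunit : ¬ IsUnit (p : ℤ_[p]) := PadicInt.irreducible_p.not_isUnit
  set b := tameExponent p W with hbdef
  have hχne := TypeLatticeNoCaseOne.reduceChar_ne_of_exponents p halg hb hb2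
  have hχ := TypeLatticeNoCaseOne.reduceChar_rel_of_exponents p halg (b := b) (by omega)
  -- divide `Ψ` by the exact power of `p`
  obtain ⟨c, m₁, Ψ₁, hΨ₁, hm₁, hndvd⟩ := exists_eq_pow_smul_not_forall_dvd hreg hunit Ψ hm
  have hΨ₁eq : IsEquivariantOnSpread ℤ_[p] p M hpM D.f
      (coordRep (Kato2004.teichmullerChar p ^ (p - 1 - b)) (Kato2004.teichmullerChar p ^ b)) Ψ₁ := by
    intro F g
    apply coordVec_eq_of_pow_smul_eq hreg c
    rw [← hΨ₁, hΨ F g, hΨ₁, map_smul]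
  -- the stable lattice `im Ψ₁`
  let Λ' : Subrepresentation (coordRep (Kato2004.teichmullerChar p ^ (p - 1 - b)) (Kato2004.teichmullerChar p ^ b)) :=
    { toSubmodule := LinearMap.range Ψ₁
      apply_mem_toSubmodule := fun g v hv => by
        obtain ⟨F, rfl⟩ := hv
        exact ⟨⟨funTranslate p g F.1, spreadLattice_translate_mem ℤ_[p] p M hpM D.f g F.2⟩, hΨ₁eq F g⟩ }
  have hmΛ : ∀ v : Option (ZMod p) → ℤ_[p], (p : ℤ_[p]) ^ m₁ • v ∈ Λ' := hm₁
  -- `im Ψ₁ = L`: otherwise the socle quotient contradicts the weight exclusion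
  have htop : Λ'.toSubmodule = ⊤ := by
    by_contra hne
    have hnz : ∃ v ∈ Λ', coordReduce (ZMod p) v ≠ 0 := by
      by_contra hall
      push Not at hall
      apply hndvd
      intro x o
      have h0 := hall (Ψ₁ x) ⟨x, rfl⟩
      exact (hker _).mp (by simpa using congr_fun h0 o)
    obtain ⟨π, hπsurj, hπeq⟩ := exists_surjective_symPowTwist_of_ne_top p
      (Kato2004.teichmullerChar p ^ (p - 1 - b)) (Kato2004.teichmullerChar p ^ b) hker hsurj hχne hχ
      (s := p - 1 - 2 * b) (by omega) Λ' hmΛ hne hnz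
    let Φ : spreadLattice ℤ_[p] p M hpM D.f →ₗ[ℤ_[p]]
        ↥(MvPolynomial.homogeneousSubmodule (Fin 2) (ZMod p) (2 * b)) := π.comp Ψ₁.rangeRestrict
    have hΦ : IsEquivariantOnSpread ℤ_[p] p M hpM D.f
        (Literature.NumberTheory.Automorphic.TwistedQuotient.resScalars ℤ_[p]
          (symPowTwist (ZMod.castHom (dvd_refl p) (ZMod p))
            (reduceChar (ZMod p) (Kato2004.teichmullerChar p ^ (p - 1 - b))) (2 * b))) Φ := by
      intro F g
      rw [Literature.NumberTheory.Automorphic.TwistedQuotient.resScalars_apply]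
      change π (Ψ₁.rangeRestrict _) = symPowTwist _ _ _ g (π (Ψ₁.rangeRestrict F))
      rw [← hπeq g]
      congr 1
      exact Subtype.ext (hΨ₁eq F g)
    have h0 : Φ = 0 := hwt p M hpM W hN D hp11 hadd hirr hGo hV4 Φ hΦ
    have hsurjΦ : Surjective Φ := hπsurj.comp (LinearMap.surjective_rangeRestrict Ψ₁)
    obtain ⟨x, hx⟩ := hsurjΦ ⟨MvPolynomial.X 0 ^ (2 * b), X_zero_pow_mem (2 * b)⟩
    rw [h0, LinearMap.zero_apply] at hx
    have hx' := congrArg Subtype.val hx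
    exact pow_ne_zero (2 * b) (MvPolynomial.X_ne_zero (0 : Fin 2)) hx'.symm
  -- conclusion: `b`, `m = 0`, the onto functional `Ψ₁`
  refine ⟨b, 0, Ψ₁, hb, hb2, hΨ₁eq, fun v => ?_, ?_⟩
  · rw [pow_zero, one_smul]
    change v ∈ Λ'.toSubmodule
    rw [htop]
    exact Submodule.mem_top
  · intro Λ'' hΛ''
    have htop'' : Λ''.toSubmodule = ⊤ := by rw [hΛ'']; exact htop
    intro N hN hN0
    exact exists_injective_symPowTwist_of_toSubmodule_eq_top p
      (Kato2004.teichmullerChar p ^ (p - 1 - b)) (Kato2004.teichmullerChar p ^ b) hker hsurj hχne hχ (by omega)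
      Λ'' htop'' N hN hN0

/-- **K from modularity, the rational functional and the weight exclusion.**  Conclusion = the route decl
`TwistedPeriodLatticeSaturation` VERBATIM; BSD is not proved by this; K is proved CONDITIONALLY on the three named
hypotheses. [cite: EdixhovenManin1991, §4] [cite: EmertonGeeSavitt2015, Lemma 4.1.1] -/
theorem twistedPeriodLatticeSaturation_of_rational_of_noEtaleWeightQuotient (hnf : exists_isNewformOf)
    (hrat : RationalTameTypeCarrierFunctional) (hwt : NoEtaleWeightQuotient) :
    Summit.BirchSwinnertonDyer.BirchSwinnertonDyer.Theses.TeichmullerTwistDescent.TwistedPeriodLatticeSaturation :=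
  twistedPeriodLatticeSaturation_of_integralTameTypeCarrierFunctional hnf
    (integralTameTypeCarrierFunctional_of_rational_of_noEtaleWeightQuotient hrat hwt)


/-! ### (W‴) ⟹ (W″): pull back along the spread period map -/

/-- **The Ash–Stevens form implies the spread-lattice form**: an equivariant functional `Φ` on `Λ_Q(f_D) = im(spreadPeriod f_D)`
with values in `Sym^{2b}(𝔽_p²) ⊗ (ω^{−b}∘det)` pulls back to `Θ = Φ ∘ spreadPeriod` on the carrier, which is equivariant
(`spreadElt_H1carrierRep`) and Hecke-eigen for `W` (`spreadPeriod_heckeT`, `T_q f_D = a_q(W) f_D` from `D.isNewformOf`); so (W‴)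
kills `Θ`, hence `Φ`. BSD is not proved by this. [cite: AshStevens1986, §1 (1.2)–(1.4)] [cite: Shimura1971, §8.3 (8.3.2)] -/
theorem noEtaleWeightQuotient_of_noEtaleWeightEigenQuotient (hW : NoEtaleWeightEigenQuotient) : NoEtaleWeightQuotient := by
  intro p M _ _ _ hpM _ _ W _ _ hN D hp11 hadd hirr hGo hV4 Φ hΦ
  letI : Algebra ℤ_[p] (ZMod p) := (PadicInt.toZMod (p := p)).toAlgebra
  -- the pulled-back functional on the carrier
  let Θ : H1carrier ℤ_[p] p M →ₗ[ℤ_[p]]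
      ↥(MvPolynomial.homogeneousSubmodule (Fin 2) (ZMod p) (2 * tameExponent p W)) :=
    Φ.comp (LinearMap.rangeRestrict (spreadPeriod ℤ_[p] p M hpM D.f))
  have hΘ : ∀ z, Θ z = Φ (spreadElt ℤ_[p] p M hpM D.f z) := fun z => rfl
  have hΘG : ∀ (g : GL (Fin 2) (ZMod p)) (z : H1carrier ℤ_[p] p M),
      Θ (H1carrierRep ℤ_[p] p M g z) =
        symPowTwist (ZMod.castHom (dvd_refl p) (ZMod p))
          (reduceChar (ZMod p) (Kato2004.teichmullerChar p ^ (p - 1 - tameExponent p W)))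
          (2 * tameExponent p W) g (Θ z) := by
    intro g z
    rw [hΘ, hΘ, spreadElt_H1carrierRep, hΦ _ g]
    rfl
  have hΘT : ∀ (q : ℕ) [NeZero q] (hq : q.Prime) (hqp : q ≠ p) (z : H1carrier ℤ_[p] p M),
      Θ (heckeT ℤ_[p] p M hq hqp z) = (((W.LFunction q : ℤ) : ZMod p)) • Θ z := by
    intro q _ hq hqp z
    have hT : HeckeRing0.toEnd (p ^ 2 * M) 2 (HeckeRing0.T (p ^ 2 * M) 2 q hq) D.f = ((W.LFunction q : ℤ) : ℂ) • D.f := by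
      have hcoef : (UpperHalfPlane.qExpansion 1 ⇑D.f).coeff q = ((W.LFunction q : ℤ) : ℂ) := D.isNewformOf.2 q
      rw [HeckeRing0.toEnd_T, D.isNewformOf.1.heckeT_eq_coeff_smul hq, hcoef]
    have hsm : spreadElt ℤ_[p] p M hpM D.f (heckeT ℤ_[p] p M hq hqp z) =
        ((W.LFunction q : ℤ) : ℤ_[p]) • spreadElt ℤ_[p] p M hpM D.f z :=
      Subtype.ext (by rw [coe_spreadElt, spreadPeriod_heckeT ℤ_[p] p M hpM hq hqp hT z, Submodule.coe_smul, coe_spreadElt])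
    rw [hΘ, hΘ, hsm, map_smul, ← algebraMap_smul (ZMod p) ((W.LFunction q : ℤ) : ℤ_[p]), map_intCast]
  have h0 : Θ = 0 := hW p M W hN hp11 hadd hirr hGo hV4 Θ hΘG hΘT
  ext x
  obtain ⟨z, hz⟩ := x.2
  have hx : x = spreadElt ℤ_[p] p M hpM D.f z := Subtype.ext hz.symm
  rw [hx, ← hΘ, h0, LinearMap.zero_apply, LinearMap.zero_apply]

/-- **K from modularity, the rational functional and the Ash–Stevens form of the weight exclusion.**  Conclusion = the route
decl `TwistedPeriodLatticeSaturation` VERBATIM; BSD is not proved by this; K is proved CONDITIONALLY on the three named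
hypotheses. [cite: EdixhovenManin1991, §4] [cite: AshStevens1986, Thm. 3.5] -/
theorem twistedPeriodLatticeSaturation_of_rational_of_noEtaleWeightEigenQuotient (hnf : exists_isNewformOf)
    (hrat : RationalTameTypeCarrierFunctional) (hW : NoEtaleWeightEigenQuotient) :
    Summit.BirchSwinnertonDyer.BirchSwinnertonDyer.Theses.TeichmullerTwistDescent.TwistedPeriodLatticeSaturation :=
  twistedPeriodLatticeSaturation_of_rational_of_noEtaleWeightQuotient hnf hrat
    (noEtaleWeightQuotient_of_noEtaleWeightEigenQuotient hW)

end KOfWeightExclusion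

end Summit.BirchSwinnertonDyer.BirchSwinnertonDyer.Theorems.TeichmullerTwistDescent
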